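import Mathlib
import HarnessLib
import Literature.AlgebraicGeometry.Ramification.InertiaNormalSylow
import Summits.ResolutionOfSingularities.ResolutionOfSingularities.Theorems.WildQuotientsWildQuotientResolutionSeparatedTameFamiliesPhaseZero

/-!
# Phase 0 ⟸ ORBIT SEPARATION: the reduction of `stub_phaseZeroHighDim` to separating the tame inert loci
# (crux `WildQuotients.WildQuotientResolution`, stub `stub_phaseZeroHighDim`; any dimension)

Crux stmt-ResolutionOfSingularities-15640 (`WildQuotientResolution`), registered stub `stub_phaseZeroHighDim`.
This file states, as a kernel-checked REDUCTION, what the standard-form route of this lineage leaves of the stub: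
`stub_phaseZeroHighDim` holds for a crux datum as soon as SOME equivariant proper birational regular model of `X′`
(faithful action, invariant structure map, `G`-stable affine cover — the shape every composite of tame / orbit /
point moves has, ✓`tameMove'`, ✓`tameOrbitMove'`) carries a list of conjugation-stable tame families with PAIRWISE
DISJOINT inert loci covering the `p′`-elements of the non-p-closed subgroups. Everything after the separation is
✓`standardise_tameFamilies` (p822832) + the criterion (p821758); the separation itself — ORBIT SEPARATION — is the
honest residual of the stub (evidence memo PHASE0-STANDARD-FORM.md §5: clean contacts separate by blowing up
joins, non-clean contacts are arbitrary hypersurface contacts, i.e. embedded resolution one dimension down).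

* `phaseZero_of_separatedTameFamilies'` — the separated-families theorem for a model in ITERABLE form (not
  necessarily finite over `X₁`);
* `phaseZero_of_orbitSeparation` — **Phase 0 for the crux datum from an orbit-separating model**.

[OURS · crux stmt-ResolutionOfSingularities-15640 · helper toward `stub_phaseZeroHighDim` (reduction of the stub to
orbit separation; NOT a proof of the stub); counted 0; AI-level work, weaker than expert review.] [folklore]
-/

-- single-problem summit: the doubled namespace component `ResolutionOfSingularities` is forced
set_option linter.dupNamespace false

noncomputable section

open CategoryTheory AlgebraicGeometry TopologicalSpace IsLocalRing
open Literature.AlgebraicGeometry.Resolution Literature.AlgebraicGeometry.Ramification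
open Scheme.IdealSheafData
open Summit.ResolutionOfSingularities.ResolutionOfSingularities.Theorems.WildQuotientResolution
open Summit.ResolutionOfSingularities.ResolutionOfSingularities.Theorems.WildQuotientResolution.PointBlowupStalkData
open Summit.ResolutionOfSingularities.ResolutionOfSingularities.Theorems.WildQuotientResolution.InertLocusStalk

namespace Summit.ResolutionOfSingularities.ResolutionOfSingularities.Theorems.WildQuotientResolution.StandardForm

/-- **Separated tame families, iterable form**: as ✓`phaseZero_of_separatedTameFamilies`, for a model `X` given with
an invariant separated locally-of-finite-type structure map to `Spec k`, a faithful action and a `G`-stable affine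
cover (instead of the crux datum's finite `q`). [folklore] -/
theorem phaseZero_of_separatedTameFamilies' (p : ℕ) (hp : p.Prime) (k : Type) [Field k] [CharP k p]
    (X : Scheme.{0}) (s : X ⟶ Spec (.of k)) [IsSeparated s] [LocallyOfFiniteType s] [IsIntegral X]
    (G : Type) [Group G] [Finite G] (ρ : G →* Aut X) (hfaith : Function.Injective ρ)
    (hreg : Scheme.IsRegular X) (hρ : ∀ g : G, (ρ g).hom ≫ s = s)
    (hcov : ∀ y : X, ∃ O : X.Opens, IsAffineOpen O ∧ y ∈ O ∧ ∀ g : G, (ρ g).hom ⁻¹ᵁ O = O)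
    (Ss : List (Finset (Subgroup G)))
    (hSs : ∀ S ∈ Ss, (∀ (g : G), ∀ K ∈ S, K.map (MulAut.conj g).toMonoidHom ∈ S) ∧ ⊥ ∉ S ∧
      ∀ K ∈ S, (Nat.card K).Coprime p)
    (hdisj : ∀ S ∈ Ss, ∀ K ∈ S, ∀ K' ∈ S, K ≠ K' →
      Disjoint {y : X | K ≤ inertiaSubgroup ρ y} {y : X | K' ≤ inertiaSubgroup ρ y})
    (hcore : ∀ H : Subgroup G, ¬ HasNormalSylow p H → ∀ h ∈ H, h ≠ 1 → (orderOf h).Coprime p →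
      ∃ S ∈ Ss, ∃ K ∈ S, K ≤ Subgroup.zpowers h) :
    ∃ (Xs : Scheme.{0}) (π : Xs ⟶ X) (ρs : G →* Aut Xs), IsProper π ∧ IsBirational π ∧
      IsIntegral Xs ∧ Scheme.IsRegular Xs ∧ (∀ g : G, (ρs g).hom ≫ π = π ≫ (ρ g).hom) ∧
      (∀ x : Xs, HasNormalSylow p (inertiaSubgroup ρs x)) ∧
      ∀ x : Xs, ∃ U : Xs.Opens, IsAffineOpen U ∧ x ∈ U ∧ ∀ g : G, (ρs g).hom ⁻¹ᵁ U = U := by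
  classical
  haveI : Fact p.Prime := ⟨hp⟩
  haveI : IsLocallyNoetherian X := LocallyOfFiniteType.isLocallyNoetherian s
  obtain ⟨Xs, π, ρs, Es, hπp, hbir, hXs, hXsreg, hequiv, hcov', hEs, hEsinv, hest⟩ :=
    standardise_tameFamilies p k Ss hSs X s ρ hfaith hreg hρ hcov hdisj [] (hasSNC_nil_of_isRegular hreg)
      (fun D hD => absurd hD (by simp)) [] (fun M hM => absurd hM (by simp))
  haveI := hπp; haveI := hXs
  have hρs : ∀ g : G, (ρs g).hom ≫ (π ≫ s) = π ≫ s := fun g => by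
    rw [← Category.assoc, hequiv g, Category.assoc, hρ g]
  have hcharS : ∀ x : Xs, CharP (ResidueField (Xs.presheaf.stalk x)) p := fun x =>
    (((IsLocalRing.residue (Xs.presheaf.stalk x)).comp ((Xs.presheaf.germ ⊤ x trivial).hom.comp
      (((π ≫ s).appTop).hom.comp (Scheme.ΓSpecIso (.of k)).inv.hom))).charP_iff_charP p).mp inferInstance
  have hZ' : ∀ K : Subgroup G, IsClosed {x : Xs | K ≤ inertiaSubgroup ρs x} := fun K =>
    PointMoveNoNpcCurves.isClosed_setOf_le_inertia (π ≫ s) ρs hρs K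
  have hEstab : ∀ D ∈ Es, ∀ g : G, (ρs g).hom.base ⁻¹' (D.support : Set Xs) = D.support :=
    fun D hD g => preimage_support_of_comap_eq ρs g (hEsinv D hD g)
  refine ⟨Xs, π, ρs, hπp, hbir, hXs, hXsreg, hequiv, fun x => ?_, hcov'⟩
  haveI := hcharS x
  haveI := hXsreg x
  let T := {D' : Xs.IdealSheafData // D' ∈ Es ∧ x ∈ D'.support}
  haveI hTfin : Finite T :=
    (((List.finite_toSet Es).subset (fun D' (h : D' ∈ Es ∧ x ∈ D'.support) => h.1)).to_subtype :
      Finite {D' : Xs.IdealSheafData | D' ∈ Es ∧ x ∈ D'.support})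
  haveI : Fintype T := Fintype.ofFinite T
  let n := Fintype.card T
  let e : T ≃ Fin n := Fintype.equivFin T
  obtain ⟨hregx, u, hu, ⟨ι, hιinj, hι⟩, -⟩ := hEs x
  have hrsop : IsRsopPart (u ∘ id) := isRsopPart_comp_of_rsop rfl u hu id Function.injective_id
  let z : Fin n → Xs.presheaf.stalk x := fun i => u (ι (e.symm i))
  have hzT : ∀ D' : T, z (e D') = u (ι D') := fun D' => by simp only [z, Equiv.symm_apply_apply]
  have hvs : ∀ D' : T, stalkIdeal (vanishingIdeal D'.1.support) x = Ideal.span {u (ι D')} := fun D' => by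
    rw [hEs.vanishingIdeal_support D'.2.1, hι D']
  by_contra hnpc
  have htame := hcore (inertiaSubgroup ρs x) hnpc
  refine hnpc (hasNormalSylow_inertia_of_standardForm ρs p x fun a τ hkey hτ =>
    ⟨n, z, fun i => hu ▸ Ideal.subset_span ⟨_, rfl⟩, fun i => hrsop.not_mem_sq _, fun g i => ?_,
      fun g hg1 hg => ?_⟩)
  · exact apply_mem_span_of_stalkIdeal_eq_span ρs x a τ hkey hτ (e.symm i).1.support
      (fun g => hEstab _ (e.symm i).2.1 (g : G)) (hvs (e.symm i)) g
  · have hg1' : (g : G) ≠ 1 := fun h => hg1 (Subtype.ext h)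
    obtain ⟨S, hS, K, hK, hKg⟩ := htame (g : G) g.2 hg1' (by rwa [Subgroup.orderOf_coe])
    have hKmem : K ∈ [] ++ (Ss.map Finset.toList).flatten := by
      rw [List.nil_append, List.mem_flatten]
      exact ⟨S.toList, List.mem_map.mpr ⟨S, hS, rfl⟩, Finset.mem_toList.mpr hK⟩
    have hsub : {y : Xs | Subgroup.zpowers (g : G) ≤ inertiaSubgroup ρs y} ⊆ ⋃ D ∈ Es, (D.support : Set Xs) :=
      hest K hKmem (g : G) (by rwa [Subgroup.orderOf_coe]) hKg
    obtain ⟨D, hD, hxD, hle⟩ :=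
      exists_mem_stalkIdeal_le_augIdeal_of_subset_iUnion ρs p x a τ hkey hτ g hg g.2 (hZ' _) Es hsub
    refine ⟨e ⟨D, hD, hxD⟩, ?_⟩
    rw [hzT]
    exact Ideal.mem_sup_left (hle ((hvs ⟨D, hD, hxD⟩) ▸ Ideal.mem_span_singleton_self _))

/-- **Phase 0 ⟸ orbit separation** (crux stmt-ResolutionOfSingularities-15640; the reduction of `stub_phaseZeroHighDim`
to its residual). Crux data: `k` of characteristic `p`, `X₁/k` separated of finite type, `X′` integral, `q : X′ → X₁`
finite, `ρ` a faithful action over `q`. Suppose there is an ORBIT-SEPARATING MODEL: an equivariant proper birational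
`π₀ : X″ → X′` with `X″` integral and regular, faithful lifted action, a `G`-stable affine cover, on which a list of
conjugation-stable families of non-trivial tame subgroups has pairwise disjoint inert loci and covers the
`p′`-elements `h ≠ 1` of every non-p-closed subgroup (`K ≤ ⟨h⟩`). Then the conclusion of `stub_phaseZeroHighDim`
holds for `X′` (all dimensions). [folklore] -/
theorem phaseZero_of_orbitSeparation (p : ℕ) (hp : p.Prime) (k : Type) [Field k] [CharP k p]
    (X' X₁ : Scheme.{0}) (f : X₁ ⟶ Spec (.of k)) (q : X' ⟶ X₁) (G : Type) [Group G] [Finite G]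
    (ρ : G →* Aut X')
    [IsSeparated f] [LocallyOfFiniteType f] [QuasiCompact f] [IsIntegral X'] [IsFinite q]
    (hρ : ∀ g : G, (ρ g).hom ≫ q = q)
    -- the orbit-separating model
    (X'' : Scheme.{0}) (π₀ : X'' ⟶ X') (ρ'' : G →* Aut X'') [IsProper π₀] (hbir₀ : IsBirational π₀)
    [IsIntegral X''] (hreg'' : Scheme.IsRegular X'') (hfaith'' : Function.Injective ρ'')
    (hequiv₀ : ∀ g : G, (ρ'' g).hom ≫ π₀ = π₀ ≫ (ρ g).hom)
    (hcov'' : ∀ y : X'', ∃ O : X''.Opens, IsAffineOpen O ∧ y ∈ O ∧ ∀ g : G, (ρ'' g).hom ⁻¹ᵁ O = O)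
    (Ss : List (Finset (Subgroup G)))
    (hSs : ∀ S ∈ Ss, (∀ (g : G), ∀ K ∈ S, K.map (MulAut.conj g).toMonoidHom ∈ S) ∧ ⊥ ∉ S ∧
      ∀ K ∈ S, (Nat.card K).Coprime p)
    (hdisj : ∀ S ∈ Ss, ∀ K ∈ S, ∀ K' ∈ S, K ≠ K' →
      Disjoint {y : X'' | K ≤ inertiaSubgroup ρ'' y} {y : X'' | K' ≤ inertiaSubgroup ρ'' y})
    (hcore : ∀ H : Subgroup G, ¬ HasNormalSylow p H → ∀ h ∈ H, h ≠ 1 → (orderOf h).Coprime p →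
      ∃ S ∈ Ss, ∃ K ∈ S, K ≤ Subgroup.zpowers h) :
    ∃ (Xs : Scheme.{0}) (π : Xs ⟶ X') (ρs : G →* Aut Xs), IsProper π ∧ IsBirational π ∧
      IsIntegral Xs ∧ Scheme.IsRegular Xs ∧ (∀ g : G, (ρs g).hom ≫ π = π ≫ (ρ g).hom) ∧
      (∀ x : Xs, HasNormalSylow p (inertiaSubgroup ρs x)) ∧
      ∀ x : Xs, ∃ U : Xs.Opens, IsAffineOpen U ∧ x ∈ U ∧ ∀ g : G, (ρs g).hom ⁻¹ᵁ U = U := by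
  have hρ'' : ∀ g : G, (ρ'' g).hom ≫ (π₀ ≫ q ≫ f) = π₀ ≫ q ≫ f := fun g => by
    rw [← Category.assoc, hequiv₀ g, Category.assoc, ← Category.assoc (ρ g).hom, hρ g]
  obtain ⟨Xs, π, ρs, hπp, hbir, hXs, hXsreg, hequiv, hNpS, hcov⟩ :=
    phaseZero_of_separatedTameFamilies' p hp k X'' (π₀ ≫ q ≫ f) G ρ'' hfaith'' hreg'' hρ'' hcov'' Ss hSs hdisj
      hcore
  haveI := hπp
  refine ⟨Xs, π ≫ π₀, ρs, inferInstance, ComponentGluing.IsBirational.comp hbir hbir₀, hXs, hXsreg, fun g => ?_,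
    hNpS, hcov⟩
  rw [← Category.assoc, hequiv g, Category.assoc, hequiv₀ g, Category.assoc]

end Summit.ResolutionOfSingularities.ResolutionOfSingularities.Theorems.WildQuotientResolution.StandardForm

end
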